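import Summits.NavierStokesRegularity.NavierStokesRegularity.Theses.AngularGalerkinLadder
import Summits.NavierStokesRegularity.NavierStokesRegularity.Theorems.NoOverheating.Negative.LadderLimitExposed
import Literature.Analysis.FluidPDE.TypeIAncientMildClassical
import Literature.Analysis.FluidPDE.PineauVicolRSSChaeWolf
import Literature.Analysis.FluidPDE.PineauVicolRSSHolds
import Summits.NavierStokesRegularity.NavierStokesRegularity.Theorems.TypeICertificateLadderTargetRssCompactnessLimit

/-!
# PRECESSING (rotated-self-similar, Pineau–Vicol) windows are EXCLUDED for small and for large
# precession rates — stratum (S6) of route `AngularGalerkinLadder`'s window sequences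

Circuit seat (ns-blowup-circuit g10), plain Negative lane of crux K2 `NoOverheating`
(`--supports` item stmt-NavierStokesRegularity-19960); no definition, no named fact.

Companion of `SelfSimilarWindowsExcluded.lean` (p515522, stratum (S5): exactly self-similar windows
excluded unconditionally) and of the positive bridge `RungBlowupCofinal/PrecessingLerayLineRungProfile`
(p518969: precessing Leray-type fields `pvAnsatz α U` — a steady profile precessing about an axis at
log-time rate `α` — are window profiles with the screw `rotZ(−2α log c)`). QUESTION (refuter4 K194
(R3) / circuit STATUS 10:25Z): can such fields populate K2's windows? ANSWER, kernel:
* `rss_of_ladderLimit` — the ladder limit of a window sequence of precessing fields with rates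
  `αₙ → α′` is again rotated-self-similar with rate `α′` and profile `v(−1, ·)` (pointwise limits,
  continuity of `rotZ` in the angle — tree `rssCompact_tendsto_rotZ_of_tendsto` —, locally uniform convergence on the slice `t = −1`);
* `no_precessingWindowSequence_small` — for every `C₀` there is `α₁ = α₁(C₀) > 0` (Pineau–Vicol
  2026 Thm 1.4, tree PROVED `pineauVicol2026_rss_liouville_holds`) such that NO admissible window
  sequence (any window, any recorded rotations) consists of precessing fields with rates
  `|αₙ| ≤ a < α₁`;
* `no_precessingWindowSequence_large` — likewise with `α₂(C₀) < b ≤ |αₙ| ≤ B`;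
* `not_cofinal_and_noOverheating_precessing_small` — reading on K1 ∧ K2.
WHAT IS LEFT OPEN (recorded, not typed): the MIDDLE RANGE `α₁ < |α| < α₂` — a precessing window
family there with `ε_L → 0` would hand K3 a Type-I rotated-self-similar ancient Navier–Stokes
solution, i.e. a counterexample to Pineau–Vicol's Conjecture 1.1 / Tsai GSM 192 Conj. 8.9 in its
open range; no theorem in the tree or in print removes it. (`α = 0` is (S5).)

LABEL: KERNEL. WHAT THIS IS NOT: not NS — no profile or window is constructed; `¬NoOverheating` is
not claimed; nothing about the MODEL roots; no item moves.
References: [cite: PineauVicol2026, Theorem 1.4, (1.7), Remarks 1.2–1.3 (arXiv:2607.09619 pp. 3–4)];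
[cite: KochNadirashviliSereginSverak2009, §4 and Lemma 6.1 (arXiv:0709.3599)].
-/

namespace Summit.NavierStokesRegularity.AngularGalerkinLadderPrecessingWindowsExcluded

open Set Filter MeasureTheory Topology Function
open Literature.Analysis Literature.Analysis.FluidPDE Literature.Analysis.FluidPDE.PineauVicol2026
open Summit.NavierStokesRegularity.FluidComputer
open Summit.NavierStokesRegularity.NavierStokesRegularity.Theses.AngularGalerkinLadder
open Summit.NavierStokesRegularity.AngularGalerkinLadderLadderLimit

/-! ### §0 Bookkeeping -/

/-- One pressure on the whole past for a field of the KNSS-gauge Type-I class (as in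
`FineRatioWindowsExcluded` / `SelfSimilarWindowsExcluded`). [cite: KochNadirashviliSereginSverak2009, §4 p. 8 (arXiv:0709.3599)] -/
private theorem exists_classical_Iio' {C : ℝ}
    {v : ℝ → EuclideanSpace ℝ (Fin 3) → EuclideanSpace ℝ (Fin 3)} (hv : IsTypeIAncientMild C v) :
    ∃ P : ℝ → EuclideanSpace ℝ (Fin 3) → ℝ, IsClassicalNSSolutionOn (Iio 0) 1 0 v P := by
  have hwin : ∀ k : ℕ, ∃ q : ℝ → EuclideanSpace ℝ (Fin 3) → ℝ,
      IsClassicalNSSolutionOn (Ioo (-((k : ℝ) + 1)) 0) 1 0 v q := fun k =>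
    hv.exists_isClassicalNSSolutionOn_Ioo (t₀ := -((k : ℝ) + 1)) (by
      have : (0 : ℝ) ≤ k := Nat.cast_nonneg k
      linarith)
  choose q hq using hwin
  refine IsClassicalNSSolutionOn.exists_pressure_Iio_of_Ioo (a := fun k : ℕ => -((k : ℝ) + 1)) hq
    fun s _ => ⟨⌈-s⌉₊, ?_⟩
  have h1 : -s ≤ (⌈-s⌉₊ : ℝ) := Nat.le_ceil (-s)
  show -((⌈-s⌉₊ : ℝ) + 1) < s
  linarith

/-- A window profile forces `0 < C₀` when `0 < δ`. [folklore] -/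
private theorem typeI_const_pos_of_window' {L : ℕ} {C₀ cmin cmax δ ε c : ℝ}
    {R : EuclideanSpace ℝ (Fin 3) ≃ₗᵢ[ℝ] EuclideanSpace ℝ (Fin 3)}
    {u : ℝ → EuclideanSpace ℝ (Fin 3) → EuclideanSpace ℝ (Fin 3)}
    {p : ℝ → EuclideanSpace ℝ (Fin 3) → ℝ}
    {d : ℝ → EuclideanSpace ℝ (Fin 3) → EuclideanSpace ℝ (Fin 3)} (hδ : 0 < δ)
    (hW : AngularLadder.IsWindowProfile L C₀ cmin cmax δ ε c R u p d) : 0 < C₀ := by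
  obtain ⟨x, hx⟩ := hW.2.2.2.1
  have hTI := hW.1.hasTypeIDecay (-1) (by norm_num) x
  have hden : 0 < ‖x‖ + Real.sqrt (-(-1 : ℝ)) := by
    have : 0 < Real.sqrt (-(-1 : ℝ)) := Real.sqrt_pos.2 (by norm_num)
    positivity
  by_contra hC
  have h0 : C₀ / (‖x‖ + Real.sqrt (-(-1 : ℝ))) ≤ 0 :=
    div_nonpos_of_nonpos_of_nonneg (not_lt.1 hC) hden.le
  linarith

/-! ### §1 Rotated self-similarity passes to the ladder limit -/

/-- **The pointwise limit of precessing fields is precessing.** If `uₙ = pvAnsatz αₙ Uₙ` with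
`αₙ → α′`, `uₙ(t, ·) → v(t, ·)` pointwise for every `t < 0`, locally uniformly on the slice `t = −1`,
and `v(−1, ·)` is continuous, then `v(t, x) = pvAnsatz α′ (v(−1, ·)) (t, x)` for all `t < 0`.
[cite: PineauVicol2026, (1.7) and Remark 1.3 (arXiv:2607.09619 pp. 3–4)] -/
theorem rss_of_ladderLimit {α : ℕ → ℝ} {α' : ℝ}
    {U : ℕ → EuclideanSpace ℝ (Fin 3) → EuclideanSpace ℝ (Fin 3)}
    {u : ℕ → ℝ → EuclideanSpace ℝ (Fin 3) → EuclideanSpace ℝ (Fin 3)}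
    {v : ℝ → EuclideanSpace ℝ (Fin 3) → EuclideanSpace ℝ (Fin 3)}
    (hu : ∀ n, u n = pvAnsatz (α n) (fun y _ => U n y)) (hα : Tendsto α atTop (𝓝 α'))
    (hpt : ∀ t < 0, ∀ x, Tendsto (fun n => u n t x) atTop (𝓝 (v t x)))
    (hlu : TendstoLocallyUniformly (fun n => u n (-1)) (v (-1)) atTop)
    (hcont : Continuous (v (-1))) :
    ∀ t < 0, ∀ x, v t x = pvAnsatz α' (fun y _ => v (-1) y) t x := by
  intro t ht x
  have hU : ∀ n, U n = u n (-1) := fun n => by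
    funext y; rw [hu n, pvAnsatz_neg_one]
  set s : ℝ := -Real.log (-t) with hs
  set lam : ℝ := (Real.sqrt (-t))⁻¹ with hlam
  -- the inner points converge
  have hy : Tendsto (fun n => rotZ (-(α n * s)) (lam • x)) atTop (𝓝 (rotZ (-(α' * s)) (lam • x))) :=
    Summit.NavierStokesRegularity.NavierStokesRegularity.Theorems.rssCompact_tendsto_rotZ_of_tendsto ((hα.mul_const s).neg) tendsto_const_nhds
  -- the profiles evaluated at the inner points converge (locally uniform convergence + continuity)
  have hUy : Tendsto (fun n => u n (-1) (rotZ (-(α n * s)) (lam • x))) atTop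
      (𝓝 (v (-1) (rotZ (-(α' * s)) (lam • x)))) :=
    hlu.tendsto_comp hcont.continuousAt hy
  -- rotate back and rescale
  have hfull : Tendsto (fun n => lam • rotZ (α n * s) (u n (-1) (rotZ (-(α n * s)) (lam • x)))) atTop
      (𝓝 (lam • rotZ (α' * s) (v (-1) (rotZ (-(α' * s)) (lam • x))))) :=
    (Summit.NavierStokesRegularity.NavierStokesRegularity.Theorems.rssCompact_tendsto_rotZ_of_tendsto (hα.mul_const s) hUy).const_smul lam
  have heq : (fun n => lam • rotZ (α n * s) (u n (-1) (rotZ (-(α n * s)) (lam • x)))) =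
      fun n => u n t x := by
    funext n
    conv_rhs => rw [hu n]
    simp only [pvAnsatz, ← hU n, hs, hlam]
  rw [heq] at hfull
  have := tendsto_nhds_unique (hpt t ht x) hfull
  rw [this]
  simp only [pvAnsatz, hs, hlam]

/-! ### §2 The small-rate stratum -/

/-- **No admissible window sequence of slowly precessing Leray-type fields.** For every `C₀` there
is `α₁ > 0` (Pineau–Vicol's small-rate threshold for the constant `C₀`) such that constants
`1 < cmin`, `0 < δ`, defect sizes `εₙ → 0`, a window rung profile with constant `C₀` at every
index (any window, any recorded rotations) whose velocity IS a precessing Leray-type field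
`uₙ = pvAnsatz αₙ Uₙ` with `|αₙ| ≤ a < α₁`, are contradictory: the ladder limit is a nontrivial
Type-I rotated-self-similar ancient classical solution with rate `|α′| ≤ a < α₁`, which
Pineau–Vicol 2026 Thm 1.4 removes. [cite: PineauVicol2026, Theorem 1.4 (arXiv:2607.09619 p. 4)] -/
theorem no_precessingWindowSequence_small (C₀ : ℝ) :
    ∃ α₁ : ℝ, 0 < α₁ ∧ ∀ {cmin cmax δ a : ℝ} {L : ℕ → ℕ} {ε c : ℕ → ℝ} {α : ℕ → ℝ}
      {R : ℕ → (EuclideanSpace ℝ (Fin 3) ≃ₗᵢ[ℝ] EuclideanSpace ℝ (Fin 3))}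
      {U : ℕ → EuclideanSpace ℝ (Fin 3) → EuclideanSpace ℝ (Fin 3)}
      {u : ℕ → ℝ → EuclideanSpace ℝ (Fin 3) → EuclideanSpace ℝ (Fin 3)}
      {p : ℕ → ℝ → EuclideanSpace ℝ (Fin 3) → ℝ}
      {d : ℕ → ℝ → EuclideanSpace ℝ (Fin 3) → EuclideanSpace ℝ (Fin 3)},
      a < α₁ → (∀ n, |α n| ≤ a) → 1 < cmin → 0 < δ → Tendsto ε atTop (𝓝 0) →
      (∀ n, AngularLadder.IsWindowProfile (L n) C₀ cmin cmax δ (ε n) (c n) (R n) (u n) (p n)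
        (d n)) →
      (∀ n, u n = pvAnsatz (α n) (fun y _ => U n y)) → False := by
  by_cases hC₀ : 0 < C₀
  · obtain ⟨α₁, α₂, hα₁, -, H⟩ := pineauVicol2026_rss_liouville_holds C₀ hC₀
    refine ⟨α₁, hα₁, fun {cmin cmax δ a L ε c α R U u p d} ha hαa hcmin hδ hε hW hu => ?_⟩
    obtain ⟨φ, c', R', v, hφ, -, -, -, hpt, hlu, -, -, hTAM, -, -, hTI, hfloor, -⟩ :=
      exists_ladderLimit_typeI hcmin hδ hε hW
    -- the rates along the extraction have a convergent subsequence
    have hbdd : ∀ n, (α (φ n)) ∈ Icc (-a) a := fun n => abs_le.1 (hαa (φ n))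
    obtain ⟨α', hα'mem, ψ, hψ, hαlim⟩ :=
      tendsto_subseq_of_bounded (Metric.isBounded_Icc (-a) a) hbdd
    have hα'le : |α'| ≤ a := abs_le.2 (isClosed_Icc.closure_subset hα'mem)
    -- data along φ ∘ ψ
    have hpt' : ∀ t < 0, ∀ x, Tendsto (fun n => u (φ (ψ n)) t x) atTop (𝓝 (v t x)) :=
      fun t ht x => (hpt t ht x).comp hψ.tendsto_atTop
    have hlu' : TendstoLocallyUniformly (fun n => u (φ (ψ n)) (-1)) (v (-1)) atTop := by
      intro W hW x
      obtain ⟨t, ht, hev⟩ := (hlu (-1) (by norm_num)) W hW x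
      exact ⟨t, ht, hψ.tendsto_atTop.eventually hev⟩
    have hcontv : Continuous (v (-1)) := by
      have h1 : ContinuousOn (uncurry v) (Iio 0 ×ˢ univ) := hTAM.1.continuousOn
      have h2 : Continuous (fun x : EuclideanSpace ℝ (Fin 3) => ((-1 : ℝ), x)) :=
        continuous_const.prodMk continuous_id
      exact (h1.comp_continuous h2 fun x => ⟨by norm_num, mem_univ _⟩)
    have hrss := rss_of_ladderLimit (fun n => hu (φ (ψ n))) hαlim hpt' hlu' hcontv
    -- smoothness of the profile `v(−1, ·)`
    have hV2 : ContDiff ℝ 2 (v (-1)) := by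
      have h1 : ContDiffOn ℝ (⊤ : ℕ∞) (uncurry v) (Iio 0 ×ˢ univ) := hTAM.1
      have h2 : ContDiff ℝ (⊤ : ℕ∞) (fun x : EuclideanSpace ℝ (Fin 3) => ((-1 : ℝ), x)) :=
        contDiff_const.prodMk contDiff_id
      have h3 := h1.comp_contDiff h2 fun x => ⟨by norm_num, mem_univ _⟩
      exact h3.of_le (by norm_cast)
    -- one pressure on the whole past; restrict to [-1, 0)
    obtain ⟨P, hP⟩ := exists_classical_Iio' hTAM
    have hP' : IsClassicalNSSolutionOn (Ico (-1) 0) 1 0 v P :=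
      hP.mono Ico_subset_Iio_self (uniqueDiffOn_Ico (-1) 0)
    have hTI' : ∀ t ∈ Ico (-1 : ℝ) 0, ∀ x : EuclideanSpace ℝ (Fin 3),
        ‖v t x‖ ≤ C₀ / (‖x‖ + Real.sqrt (-t)) := fun t ht x => hTI t ht.2 x
    have hA : ∀ t ∈ Ico (-1 : ℝ) 0, ∀ x : EuclideanSpace ℝ (Fin 3),
        v t x = pvAnsatz α' (fun y _ => v (-1) y) t x := fun t ht x => hrss t ht.2 x
    have hzero : v (-1) = 0 := H α' v P (v (-1)) hP' hTI' hV2 hA (Or.inl (lt_of_le_of_lt hα'le ha))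
    obtain ⟨x, hx⟩ := hfloor
    rw [hzero] at hx
    simp at hx
    exact absurd hx (not_le.2 hδ)
  · refine ⟨1, one_pos, fun {cmin cmax δ a L ε c α R U u p d} _ _ _ hδ _ hW _ => ?_⟩
    exact hC₀ (typeI_const_pos_of_window' hδ (hW 0))

/-! ### §3 The large-rate stratum -/

/-- **No admissible window sequence of fast-precessing Leray-type fields**: same as
`no_precessingWindowSequence_small` with rates in a band `α₂(C₀) < b ≤ |αₙ| ≤ B`
(Pineau–Vicol 2026 Thm 1.4, large rates). [cite: PineauVicol2026, Theorem 1.4 (arXiv:2607.09619 p. 4)] -/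
theorem no_precessingWindowSequence_large (C₀ : ℝ) :
    ∃ α₂ : ℝ, 0 < α₂ ∧ ∀ {cmin cmax δ b B : ℝ} {L : ℕ → ℕ} {ε c : ℕ → ℝ} {α : ℕ → ℝ}
      {R : ℕ → (EuclideanSpace ℝ (Fin 3) ≃ₗᵢ[ℝ] EuclideanSpace ℝ (Fin 3))}
      {U : ℕ → EuclideanSpace ℝ (Fin 3) → EuclideanSpace ℝ (Fin 3)}
      {u : ℕ → ℝ → EuclideanSpace ℝ (Fin 3) → EuclideanSpace ℝ (Fin 3)}
      {p : ℕ → ℝ → EuclideanSpace ℝ (Fin 3) → ℝ}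
      {d : ℕ → ℝ → EuclideanSpace ℝ (Fin 3) → EuclideanSpace ℝ (Fin 3)},
      α₂ < b → (∀ n, b ≤ |α n| ∧ |α n| ≤ B) → 1 < cmin → 0 < δ → Tendsto ε atTop (𝓝 0) →
      (∀ n, AngularLadder.IsWindowProfile (L n) C₀ cmin cmax δ (ε n) (c n) (R n) (u n) (p n)
        (d n)) →
      (∀ n, u n = pvAnsatz (α n) (fun y _ => U n y)) → False := by
  by_cases hC₀ : 0 < C₀
  · obtain ⟨α₁, α₂, -, hα₂, H⟩ := pineauVicol2026_rss_liouville_holds C₀ hC₀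
    refine ⟨α₂, hα₂, fun {cmin cmax δ b B L ε c α R U u p d} hb hαb hcmin hδ hε hW hu => ?_⟩
    obtain ⟨φ, c', R', v, hφ, -, -, -, hpt, hlu, -, -, hTAM, -, -, hTI, hfloor, -⟩ :=
      exists_ladderLimit_typeI hcmin hδ hε hW
    have hbdd : ∀ n, (α (φ n)) ∈ Icc (-B) B := fun n => abs_le.1 (hαb (φ n)).2
    obtain ⟨α', hα'mem, ψ, hψ, hαlim⟩ :=
      tendsto_subseq_of_bounded (Metric.isBounded_Icc (-B) B) hbdd
    -- |α'| ≥ b: the absolute values converge and stay ≥ b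
    have hα'ge : b ≤ |α'| :=
      ge_of_tendsto ((continuous_abs.tendsto α').comp hαlim) (Eventually.of_forall fun n => (hαb _).1)
    have hpt' : ∀ t < 0, ∀ x, Tendsto (fun n => u (φ (ψ n)) t x) atTop (𝓝 (v t x)) :=
      fun t ht x => (hpt t ht x).comp hψ.tendsto_atTop
    have hlu' : TendstoLocallyUniformly (fun n => u (φ (ψ n)) (-1)) (v (-1)) atTop := by
      intro W hW x
      obtain ⟨t, ht, hev⟩ := (hlu (-1) (by norm_num)) W hW x
      exact ⟨t, ht, hψ.tendsto_atTop.eventually hev⟩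
    have hcontv : Continuous (v (-1)) := by
      have h1 : ContinuousOn (uncurry v) (Iio 0 ×ˢ univ) := hTAM.1.continuousOn
      have h2 : Continuous (fun x : EuclideanSpace ℝ (Fin 3) => ((-1 : ℝ), x)) :=
        continuous_const.prodMk continuous_id
      exact (h1.comp_continuous h2 fun x => ⟨by norm_num, mem_univ _⟩)
    have hrss := rss_of_ladderLimit (fun n => hu (φ (ψ n))) hαlim hpt' hlu' hcontv
    have hV2 : ContDiff ℝ 2 (v (-1)) := by
      have h1 : ContDiffOn ℝ (⊤ : ℕ∞) (uncurry v) (Iio 0 ×ˢ univ) := hTAM.1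
      have h2 : ContDiff ℝ (⊤ : ℕ∞) (fun x : EuclideanSpace ℝ (Fin 3) => ((-1 : ℝ), x)) :=
        contDiff_const.prodMk contDiff_id
      have h3 := h1.comp_contDiff h2 fun x => ⟨by norm_num, mem_univ _⟩
      exact h3.of_le (by norm_cast)
    obtain ⟨P, hP⟩ := exists_classical_Iio' hTAM
    have hP' : IsClassicalNSSolutionOn (Ico (-1) 0) 1 0 v P :=
      hP.mono Ico_subset_Iio_self (uniqueDiffOn_Ico (-1) 0)
    have hTI' : ∀ t ∈ Ico (-1 : ℝ) 0, ∀ x : EuclideanSpace ℝ (Fin 3),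
        ‖v t x‖ ≤ C₀ / (‖x‖ + Real.sqrt (-t)) := fun t ht x => hTI t ht.2 x
    have hA : ∀ t ∈ Ico (-1 : ℝ) 0, ∀ x : EuclideanSpace ℝ (Fin 3),
        v t x = pvAnsatz α' (fun y _ => v (-1) y) t x := fun t ht x => hrss t ht.2 x
    have hzero : v (-1) = 0 :=
      H α' v P (v (-1)) hP' hTI' hV2 hA (Or.inr (lt_of_lt_of_le hb hα'ge))
    obtain ⟨x, hx⟩ := hfloor
    rw [hzero] at hx
    simp at hx
    exact absurd hx (not_le.2 hδ)
  · refine ⟨1, one_pos, fun {cmin cmax δ b B L ε c α R U u p d} _ _ _ hδ _ hW _ => ?_⟩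
    exact hC₀ (typeI_const_pos_of_window' hδ (hW 0))

/-! ### §4 Reading on the open cruxes -/

/-- **K1 ∧ (K2 met by slowly precessing Leray-type fields) is FALSE.** With `α₁(C₀)` from
`no_precessingWindowSequence_small`: `RungBlowupCofinal` together with a `NoOverheating` (constant
`C₀`) whose window profiles are precessing Leray-type fields with rates `|α_L| ≤ a < α₁` is
contradictory. [cite: PineauVicol2026, Theorem 1.4 (arXiv:2607.09619 p. 4)] -/
theorem not_cofinal_and_noOverheating_precessing_small (C₀ : ℝ) :
    ∃ α₁ : ℝ, 0 < α₁ ∧ ∀ a : ℝ, a < α₁ → ¬ (RungBlowupCofinal ∧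
      ∃ (cmin cmax δ : ℝ) (L₀ : ℕ) (ε : ℕ → ℝ), 1 < cmin ∧ 0 < δ ∧
        Tendsto ε atTop (𝓝 0) ∧
        ∀ L ≥ L₀, AngularLadder.RungIsSingular L →
          ∃ (c : ℝ) (R : EuclideanSpace ℝ (Fin 3) ≃ₗᵢ[ℝ] EuclideanSpace ℝ (Fin 3))
            (α : ℝ) (U : EuclideanSpace ℝ (Fin 3) → EuclideanSpace ℝ (Fin 3))
            (p : ℝ → EuclideanSpace ℝ (Fin 3) → ℝ)
            (d : ℝ → EuclideanSpace ℝ (Fin 3) → EuclideanSpace ℝ (Fin 3)),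
            AngularLadder.IsWindowProfile L C₀ cmin cmax δ (ε L) c R (pvAnsatz α (fun y _ => U y)) p d ∧
              |α| ≤ a) := by
  obtain ⟨α₁, hα₁, H⟩ := no_precessingWindowSequence_small C₀
  refine ⟨α₁, hα₁, fun a ha => ?_⟩
  rintro ⟨h₁, cmin, cmax, δ, L₀, ε, hcmin, hδ, hε, hwin⟩
  choose L hLge hLsing using fun n : ℕ => h₁ (max L₀ n)
  choose c R α U p d hW hαa using fun n : ℕ =>
    hwin (L n) (le_trans (le_max_left _ _) (hLge n)) (hLsing n)
  have hε' : Tendsto (fun n : ℕ => ε (L n)) atTop (𝓝 0) :=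
    hε.comp (tendsto_atTop_mono (fun n => le_trans (le_max_right _ _) (hLge n)) tendsto_id)
  exact H (u := fun n => pvAnsatz (α n) (fun y _ => U n y)) ha hαa hcmin hδ hε' hW fun _ => rfl

end Summit.NavierStokesRegularity.AngularGalerkinLadderPrecessingWindowsExcluded
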